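import Summits.Langlands.Langlands.Theses.ExteriorSquareAscent
import Literature.NumberTheory.GaloisRepresentations.PowLocallyAlgebraicProofs
import Literature.NumberTheory.GaloisRepresentations.WeakAbelianDirectSummandCyclotomicProofs
import Literature.NumberTheory.Automorphic.ReciprocityGLn
import Summits.Langlands.Langlands.Theorems.ExteriorSquareAscentReducibleInducesSquareStubLineHecke

/-!
# Stub `stub_planesHecke` of line `Sketch` for crux stmt-Langlands-18054
(`Summit.Langlands.Langlands.Theses.ExteriorSquareAscent.ReducibleInducesSquare`)

The Galois → automorphic passage of the `(2,2)` case (Böckle–Hui 2025, Thm. 1.1 and §3.2.1;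
Shavali 2026, Prop. 4.2).  Let `π` be cuspidal on `GL₄(𝔸_K)`, `ρ : Γ_K → GL₄(ℚ̄_ℓ)` a.e.
Satake–Frobenius compatible with `(π, ι)` and `E`-rational for some number field `E`,
`S : Γ_K →ₜ* GL₂(ℚ̄_ℓ)` a block of `ρ` (`charpoly S(g) ∣ charpoly ρ(g)`), `ψ = det ∘ S` a character
weakly dividing an `E`-rational `ρ' : Γ_K →ₜ* GL₆(ℚ̄_ℓ)`.  Then there is a Hecke character `χ` of
`K` splitting the Satake multisets: `t_{π,v} = β + γ`, `|β| = 2`, `∏ β = χ(ϖ_v)` for almost all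
`v`:

* Böckle–Hui's Theorem 1.1 WITHOUT its (idle) semisimplicity hypothesis
  (`exists_heckeCharacter_of_weaklyDivides'`): the body of the tree's
  `exists_heckeCharacter_of_weaklyDivides_of_thm22` — idelic avatar
  (`FramedGaloisRep.exists_idelicCharacter_eventually`), algebraicity of Frobenius values
  (`FramedGaloisRep.WeaklyDivides.eventually_isAlgebraic`), BH Thm. 2.2
  (`LogLinear.pow_isLocallyAlgebraic_of_frobenius_isAlgebraic`) and the Hecke avatar
  (`FramedGaloisRep.WeaklyDivides.exists_heckeCharacter_of_almostLocAlg`) — gives an algebraic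
  Hecke character `χ₁` with `ψ(Frob_v) = ι⁻¹(χ₁(ϖ_v))⁻¹` a.e.;
* at a good place, `charpoly S(Frob_v)` divides
  `arithFrobPolyOfSatake ι q_v 4 α = ∏_{a ∈ α} (X - ι⁻¹(((√q_v)³ a)⁻¹))`, so its roots are
  `ι⁻¹(((√q_v)³ b)⁻¹)`, `b ∈ β`, for a sub-multiset `β ≤ α` of size `2`, and
  `det S(Frob_v) = ∏_{b ∈ β} ι⁻¹(((√q_v)³ b)⁻¹)` (`exists_det_eq_prod_of_charpoly_dvd_of_frob`,
  `Matrix.det_eq_prod_roots_charpoly`, `Polynomial.roots.le_of_dvd`, `roots_arithFrobPolyOfSatake`);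
* hence `χ₁(ϖ_v) = q_v³ ∏ β`, and `χ := χ₁ ‖·‖³` (`HeckeCharacter.normCharacter`,
  `HeckeCharacter.valueAtUniformizer_normCharacter`: `‖ϖ_v‖ = q_v⁻¹`) has `χ(ϖ_v) = ∏ β`;
  uniqueness of Satake parameters (`AutomorphicRepData.hasSatakeParamAt_unique_holds`) turns
  `∃ α` into `∀ α`.
-/

set_option linter.dupNamespace false -- `Summit.Langlands.Langlands` is the mandated namespace (lakefile weak.linter.dupNamespace)

noncomputable section

namespace Summit.Langlands.Langlands.Cruxes.ReducibleInducesSquare.Sketch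

open Literature.NumberTheory.GaloisRepresentations Literature.NumberTheory.Automorphic
open NumberField IsDedekindDomain Field Filter Polynomial
open scoped Classical Matrix MatrixGroups NumberField

/-! ### Böckle–Hui, Theorem 1.1 for characters, without the semisimplicity hypothesis -/

section BH

variable {K : Type} [Field K] [NumberField K] {ℓ : ℕ} [Fact ℓ.Prime] {d : ℕ}

/-- **Böckle–Hui Thm. 1.1 (characters, Hecke form), semisimplicity dropped.**  For a number field
`E` with `e : E → ℚ̄_ℓ`, an `E`-rational `ρ : Γ_K →ₜ* GL_d(ℚ̄_ℓ)` and a character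
`ψ : Γ_K →ₜ* GL_1(ℚ̄_ℓ)` weakly dividing `ρ`, for every `ι : ℚ̄_ℓ ≃+* ℂ` there is an algebraic
Hecke character `χ` with `χ`, `ψ` unramified and `ψ.HasFrobCharpolyAt v (X - C (ι⁻¹(χ(ϖ_v))⁻¹))`
at almost all `v`.  The body of the tree's `exists_heckeCharacter_of_weaklyDivides_of_thm22`, fed
with the tree's proof of BH Thm. 2.2 (`LogLinear.pow_isLocallyAlgebraic_of_frobenius_isAlgebraic`);
the semisimplicity hypothesis of the named fact is not used by that body.
[cite: BockleHui2025, Theorem 1.1, Theorem 2.2 and §2.7] -/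
theorem exists_heckeCharacter_of_weaklyDivides' {E : Type} [Field E] [NumberField E]
    (e : E →+* PadicAlgCl ℓ) {ρ : FramedGaloisRep K (PadicAlgCl ℓ) d} (hρ : ρ.IsRationalOver e)
    {ψ : FramedGaloisRep K (PadicAlgCl ℓ) 1} (h : ψ.WeaklyDivides ρ) (ι : PadicAlgCl ℓ ≃+* ℂ) :
    ∃ χ : HeckeCharacter K, χ.IsAlgebraic ∧
      ∀ᶠ v : HeightOneSpectrum (𝓞 K) in cofinite, χ.IsUnramifiedAt v ∧ ψ.IsUnramifiedAt v ∧
        ψ.HasFrobCharpolyAt v (X - C (ι.symm (χ.valueAtUniformizer v)⁻¹)) := by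
  classical
  -- the idelic avatar `Ψ = ψ ∘ Art_K`
  obtain ⟨Ψ, hK, hΨ⟩ := ψ.exists_idelicCharacter_eventually
  -- `L = S_ℓ`
  have hfin : {v : HeightOneSpectrum (𝓞 K) | (ℓ : 𝓞 K) ∈ v.asIdeal}.Finite := by
    have hne : (Ideal.span {(ℓ : 𝓞 K)} : Ideal (𝓞 K)) ≠ ⊥ := by
      rw [Ne, Ideal.span_singleton_eq_bot, Nat.cast_eq_zero]
      exact (Fact.out : ℓ.Prime).ne_zero
    refine (Ideal.finite_factors hne).subset fun v hv => ?_
    simp only [Set.mem_setOf_eq] at hv ⊢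
    exact (Ideal.dvd_span_singleton).mpr hv
  set L : Finset (HeightOneSpectrum (𝓞 K)) := hfin.toFinset with hLdef
  have hL : ∀ v, v ∈ L ↔ (ℓ : 𝓞 K) ∈ v.asIdeal := fun v => hfin.mem_toFinset
  -- the hypotheses of Thm. 2.2 for `ψ` (Prop. 2.4: `ψ(Frob_v)` is a root of `P_v^e`)
  have halg : ∀ᶠ v : HeightOneSpectrum (𝓞 K) in cofinite, ψ.IsUnramifiedAt v ∧
      ∀ 𝔓 ∈ v.primesAbove, ∀ σ : absoluteGaloisGroup K, IsArithFrobAt (𝓞 K) σ 𝔓 →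
        IsAlgebraic ℚ ((((ψ σ : GL (Fin 1) (PadicAlgCl ℓ)) :
          Matrix (Fin 1) (Fin 1) (PadicAlgCl ℓ)) 0 0)) :=
    (FramedGaloisRep.WeaklyDivides.eventually_isAlgebraic e hρ h).mono fun v hv => ⟨hv.2.1, hv.2.2⟩
  -- Thm. 2.2
  obtain ⟨N, hN, n, m, hLA⟩ :=
    LogLinear.pow_isLocallyAlgebraic_of_frobenius_isAlgebraic ψ Ψ hK hΨ halg L hL
  -- Steps 3–4 and the Hecke avatar
  exact FramedGaloisRep.WeaklyDivides.exists_heckeCharacter_of_almostLocAlg e hρ h Ψ hK hΨ L hL hN n m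
    hLA ι

end BH

/-! ### Per-place core: the determinant of a block at Frobenius -/

section OnePlace

variable {K : Type} [Field K] [NumberField K] {ℓ : ℕ} [Fact ℓ.Prime] {n m : ℕ}

/-- `a ↦ ι⁻¹((c a)⁻¹)` has the left inverse `x ↦ c⁻¹ (ι x)⁻¹` (`c ≠ 0`). [folklore] -/
theorem leftInverse_symm_inv_mul (ι : PadicAlgCl ℓ ≃+* ℂ) {c : ℂ} (hc : c ≠ 0) :
    Function.LeftInverse (fun x : PadicAlgCl ℓ => c⁻¹ * (ι x)⁻¹)
      (fun a : ℂ => ι.symm ((c * a)⁻¹)) := by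
  intro a
  simp only [RingEquiv.apply_symm_apply, inv_inv]
  rw [inv_mul_cancel_left₀ hc]

/-- A sub-multiset of an image `α.map r`, for `r` with a left inverse, is the image of a
sub-multiset of `α`. [folklore] -/
theorem exists_le_map_eq_of_leftInverse {A B : Type*} {r : A → B} {rinv : B → A}
    (h : Function.LeftInverse rinv r) {μ : Multiset B} {α : Multiset A} (hle : μ ≤ α.map r) :
    ∃ β ≤ α, β.map r = μ := by
  have hmap : (μ.map rinv).map r = μ := by
    rw [Multiset.map_map]
    conv_rhs => rw [← Multiset.map_id μ]
    refine Multiset.map_congr rfl fun x hx => ?_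
    obtain ⟨a, -, rfl⟩ := Multiset.mem_map.mp (Multiset.mem_of_le hle hx)
    simp [h a]
  refine ⟨μ.map rinv, ?_, hmap⟩
  rw [← Multiset.map_le_map_iff h.injective, hmap]
  exact hle

/-- `∏_{a ∈ β} ι⁻¹((c a)⁻¹) = ι⁻¹((c^{|β|} ∏ β)⁻¹)`. [folklore] -/
theorem prod_map_symm_inv_mul (ι : PadicAlgCl ℓ ≃+* ℂ) (c : ℂ) (β : Multiset ℂ) :
    (β.map fun a => ι.symm ((c * a)⁻¹)).prod = ι.symm ((c ^ Multiset.card β * β.prod)⁻¹) := by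
  have h1 : (β.map fun a => ι.symm ((c * a)⁻¹)) = (β.map fun a => (c * a)⁻¹).map ι.symm := by
    rw [Multiset.map_map]
    rfl
  rw [h1, ← map_multiset_prod, Multiset.prod_map_inv, Multiset.prod_map_mul, Multiset.map_const',
    Multiset.prod_replicate, Multiset.map_id']

/-- **The determinant of a block at a good place.**  If `charpoly S(g) ∣ charpoly r(g)` for all
`g` (`S` of rank `m`, `r` of rank `n`) and `det(X - r(σ)) = arithFrobPolyOfSatake ι q_v n α` for
the arithmetic Frobenii `σ` at `v`, then for every such `σ` there is a sub-multiset `β ≤ α` of size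
`m` with `det S(σ) = ∏_{b ∈ β} ι⁻¹(((√q_v)^{n-1} b)⁻¹)`: `charpoly S(σ)` splits (`ℚ̄_ℓ` is
algebraically closed), its roots form a sub-multiset of the roots `ι⁻¹(((√q_v)^{n-1} a)⁻¹)`,
`a ∈ α`, of `charpoly r(σ)` (`Polynomial.roots.le_of_dvd`, `roots_arithFrobPolyOfSatake`), and
`det S(σ)` is the product of the roots (`Matrix.det_eq_prod_roots_charpoly`).
[cite: BockleHui2025, §3.2.1] -/
theorem exists_det_eq_prod_of_charpoly_dvd_of_frob (ι : PadicAlgCl ℓ ≃+* ℂ)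
    (r : FramedGaloisRep K (PadicAlgCl ℓ) n) (S : FramedGaloisRep K (PadicAlgCl ℓ) m)
    (hS : ∀ g : absoluteGaloisGroup K, FramedRep.charpoly S g ∣ FramedRep.charpoly r g)
    {v : HeightOneSpectrum (𝓞 K)} {α : Multiset ℂ}
    (hP : r.HasFrobCharpolyAt v (arithFrobPolyOfSatake ι v.residueCard n α)) :
    ∀ 𝔓 ∈ v.primesAbove, ∀ σ : absoluteGaloisGroup K, IsArithFrobAt (𝓞 K) σ 𝔓 →
      ∃ β ≤ α, Multiset.card β = m ∧
        ((S σ : GL (Fin m) (PadicAlgCl ℓ)) : Matrix (Fin m) (Fin m) (PadicAlgCl ℓ)).det =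
          (β.map fun a =>
            ι.symm ((((Real.sqrt (v.residueCard : ℝ) : ℝ) : ℂ) ^ (n - 1) * a)⁻¹)).prod := by
  intro 𝔓 h𝔓 σ hσ
  set c : ℂ := ((Real.sqrt (v.residueCard : ℝ) : ℝ) : ℂ) ^ (n - 1) with hc_def
  have hc : c ≠ 0 := by
    refine pow_ne_zero _ ?_
    rw [Complex.ofReal_ne_zero]
    exact Real.sqrt_ne_zero'.2 (by exact_mod_cast lt_trans zero_lt_one v.one_lt_residueCard)
  have hchar : FramedRep.charpoly r σ = arithFrobPolyOfSatake ι v.residueCard n α := hP 𝔓 h𝔓 σ hσ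
  have hne : arithFrobPolyOfSatake ι v.residueCard n α ≠ 0 := by
    refine (Polynomial.monic_multiset_prod_of_monic _ _ fun a _ => ?_).ne_zero
    exact Polynomial.monic_X_sub_C _
  set M : Matrix (Fin m) (Fin m) (PadicAlgCl ℓ) :=
    ((S σ : GL (Fin m) (PadicAlgCl ℓ)) : Matrix (Fin m) (Fin m) (PadicAlgCl ℓ)) with hM
  have hMS : FramedRep.charpoly S σ = M.charpoly := rfl
  have hsplit : M.charpoly.Splits := IsAlgClosed.splits _
  have hcard : Multiset.card M.charpoly.roots = m := by
    rw [← hsplit.natDegree_eq_card_roots, Matrix.charpoly_natDegree_eq_dim, Fintype.card_fin]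
  have hdvd : M.charpoly ∣ arithFrobPolyOfSatake ι v.residueCard n α := by
    rw [← hMS, ← hchar]
    exact hS σ
  have hle : M.charpoly.roots ≤ α.map fun a => ι.symm ((c * a)⁻¹) := by
    rw [hc_def, ← roots_arithFrobPolyOfSatake]
    exact Polynomial.roots.le_of_dvd hne hdvd
  obtain ⟨β, hβ, hβμ⟩ := exists_le_map_eq_of_leftInverse (leftInverse_symm_inv_mul ι hc) hle
  refine ⟨β, hβ, ?_, ?_⟩
  · rw [← hcard, ← hβμ, Multiset.card_map]
  · rw [Matrix.det_eq_prod_roots_charpoly, ← hβμ]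

/-- **The Hecke character of the block determinant, read at Satake level, at one good place.**
If moreover `ψ(g)₀₀ = det S(g)` and `ψ(Frob_v) = ι⁻¹(χ(ϖ_v))⁻¹`
(`ψ.HasFrobCharpolyAt v (X - C (ι⁻¹(χ(ϖ_v))⁻¹))`), then
`χ(ϖ_v) = (√q_v)^{(n-1) m} ∏ β` for some `β ≤ α` of size `m` (a Frobenius at `v` exists:
`HeightOneSpectrum.primesAbove_nonempty`,
`HeightOneSpectrum.exists_isArithFrobAt_of_mem_primesAbove_holds`). [cite: BockleHui2025, §3.2.1] -/
theorem exists_le_valueAtUniformizer_eq_of_frob (ι : PadicAlgCl ℓ ≃+* ℂ)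
    (r : FramedGaloisRep K (PadicAlgCl ℓ) n) (S : FramedGaloisRep K (PadicAlgCl ℓ) m)
    (hS : ∀ g : absoluteGaloisGroup K, FramedRep.charpoly S g ∣ FramedRep.charpoly r g)
    (ψ : FramedGaloisRep K (PadicAlgCl ℓ) 1)
    (hψ : ∀ g : absoluteGaloisGroup K,
      ((ψ g : GL (Fin 1) (PadicAlgCl ℓ)) : Matrix (Fin 1) (Fin 1) (PadicAlgCl ℓ)) 0 0 =
        ((S g : GL (Fin m) (PadicAlgCl ℓ)) : Matrix (Fin m) (Fin m) (PadicAlgCl ℓ)).det)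
    {v : HeightOneSpectrum (𝓞 K)} {α : Multiset ℂ}
    (hP : r.HasFrobCharpolyAt v (arithFrobPolyOfSatake ι v.residueCard n α))
    {χ : HeckeCharacter K}
    (hχ : ψ.HasFrobCharpolyAt v (X - C (ι.symm (χ.valueAtUniformizer v)⁻¹))) :
    ∃ β ≤ α, Multiset.card β = m ∧
      χ.valueAtUniformizer v =
        (((Real.sqrt (v.residueCard : ℝ) : ℝ) : ℂ) ^ (n - 1)) ^ m * β.prod := by
  obtain ⟨𝔓, h𝔓⟩ := HeightOneSpectrum.primesAbove_nonempty v
  obtain ⟨σ, hσ⟩ := HeightOneSpectrum.exists_isArithFrobAt_of_mem_primesAbove_holds h𝔓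
  obtain ⟨β, hβ, hcard, hdet⟩ := exists_det_eq_prod_of_charpoly_dvd_of_frob ι r S hS hP 𝔓 h𝔓 σ hσ
  refine ⟨β, hβ, hcard, ?_⟩
  have hch := (FramedGaloisRep.hasFrobCharpolyAt_iff_of_rank_one ψ v _).mp hχ 𝔓 h𝔓 σ hσ
  rw [hψ σ, hdet, prod_map_symm_inv_mul, hcard] at hch
  have h2 := ι.symm.injective hch
  rw [inv_inj] at h2
  exact h2.symm

end OnePlace

/-! ### Bookkeeping: `((√q)³)² = q³` and powers of Hecke characters at a uniformizer -/

/-- `((√q)³)² = q³` in `ℂ`. [folklore] -/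
theorem ofReal_sqrt_pow_three_sq (q : ℕ) :
    (((Real.sqrt (q : ℝ) : ℝ) : ℂ) ^ 3) ^ 2 = (q : ℂ) ^ 3 := by
  rw [← pow_mul, show 3 * 2 = 2 * 3 from rfl, pow_mul, ← Complex.ofReal_pow,
    Real.sq_sqrt (Nat.cast_nonneg q), Complex.ofReal_natCast]

/-- `(χ ^ k)(ϖ_v) = χ(ϖ_v) ^ k`. [folklore] -/
theorem valueAtUniformizer_pow_eq {K : Type} [Field K] [NumberField K] (χ : HeckeCharacter K)
    (k : ℕ) (v : HeightOneSpectrum (𝓞 K)) :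
    (χ ^ k).valueAtUniformizer v = χ.valueAtUniformizer v ^ k := by
  simp only [HeckeCharacter.valueAtUniformizer, HeckeCharacter.localComponent_apply,
    HeckeCharacter.pow_apply, Units.val_pow_eq_pow_val]

/-! ### The stub -/

/-- **STUB D — the determinant of a stable plane is a Hecke character splitting the Satake
multisets (any `K`).**  For `π` cuspidal on `GL₄(𝔸_K)`, `ρ : Γ_K → GL₄(ℚ̄_ℓ)` a.e.
Satake–Frobenius compatible with `(π, ι)` and `E`-rational for some number field `E`, a block
`S : Γ_K →ₜ* GL₂(ℚ̄_ℓ)` of `ρ` (`charpoly S(g) ∣ charpoly ρ(g)`), and the character `ψ = det S`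
weakly dividing an `E`-rational `ρ' : Γ_K →ₜ* GL₆(ℚ̄_ℓ)`: there is a Hecke character `χ` of `K`
with `t_{π,v} = β + γ`, `|β| = 2`, `∏ β = χ(ϖ_v)` for almost all `v`.  Route: Böckle–Hui Thm 1.1
(semisimplicity dropped, `exists_heckeCharacter_of_weaklyDivides'`) makes `ψ` an algebraic Hecke
character `χ₁`, `ψ(Frob_v) = ι⁻¹(χ₁(ϖ_v))⁻¹`; `det S(Frob_v)` is the product of two roots
`ι⁻¹(((√q_v)³ b)⁻¹)`, `b ∈ β ≤ t_{π,v}`, `|β| = 2` (`exists_le_valueAtUniformizer_eq_of_frob`), so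
`χ₁(ϖ_v) = q_v³ ∏ β` and `χ := χ₁ ‖·‖³` (`HeckeCharacter.valueAtUniformizer_normCharacter`)
works; `∃ α ↦ ∀ α` by `AutomorphicRepData.hasSatakeParamAt_unique_holds`.
[cite: BockleHui2025, Thm. 1.1 and §3.2.1] [cite: Shavali2026, Prop. 4.2] -/
theorem stub_planesHecke :
    ∀ (K : Type) [Field K] [NumberField K]
      (hcpt : Literature.NumberTheory.Automorphic.isCompact_glFiniteIntegralLevel 4 K)
      (π : Literature.NumberTheory.Automorphic.CuspidalAutomorphicRepData 4 K hcpt)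
      (ℓ : ℕ) [Fact ℓ.Prime] (ι : PadicAlgCl ℓ ≃+* ℂ)
      (ρ : Literature.NumberTheory.GaloisRepresentations.FramedGaloisRep K (PadicAlgCl ℓ) 4),
      (∀ᶠ v : IsDedekindDomain.HeightOneSpectrum (NumberField.RingOfIntegers K) in Filter.cofinite,
        ∃ α : Multiset ℂ, π.1.HasSatakeParamAt v α ∧ ρ.IsUnramifiedAt v ∧
          ρ.HasFrobCharpolyAt v
            (Literature.NumberTheory.Automorphic.arithFrobPolyOfSatake ι v.residueCard 4 α)) →
      (∃ (E : Type) (_ : Field E) (_ : NumberField E) (e : E →+* PadicAlgCl ℓ), ρ.IsRationalOver e) →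
      ∀ (S : Literature.NumberTheory.GaloisRepresentations.FramedGaloisRep K (PadicAlgCl ℓ) 2),
        (∀ g : Field.absoluteGaloisGroup K,
          Literature.NumberTheory.GaloisRepresentations.FramedRep.charpoly S g ∣
            Literature.NumberTheory.GaloisRepresentations.FramedRep.charpoly ρ g) →
        ∀ (ψ : Literature.NumberTheory.GaloisRepresentations.FramedGaloisRep K (PadicAlgCl ℓ) 1)
          (ρ' : Literature.NumberTheory.GaloisRepresentations.FramedGaloisRep K (PadicAlgCl ℓ) 6),
          (∀ g : Field.absoluteGaloisGroup K,
            ((ψ g : Matrix.GeneralLinearGroup (Fin 1) (PadicAlgCl ℓ)) :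
                Matrix (Fin 1) (Fin 1) (PadicAlgCl ℓ)) 0 0 =
              ((S g : Matrix.GeneralLinearGroup (Fin 2) (PadicAlgCl ℓ)) :
                Matrix (Fin 2) (Fin 2) (PadicAlgCl ℓ)).det) →
          ψ.WeaklyDivides ρ' →
          (∀ (E : Type) [Field E] [NumberField E] (e : E →+* PadicAlgCl ℓ),
            ρ.IsRationalOver e → ρ'.IsRationalOver e) →
          ∃ χ : Literature.NumberTheory.GaloisRepresentations.HeckeCharacter K,
            ∀ᶠ v : IsDedekindDomain.HeightOneSpectrum (NumberField.RingOfIntegers K) in Filter.cofinite,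
              ∀ α : Multiset ℂ, π.1.HasSatakeParamAt v α →
                ∃ β γ : Multiset ℂ, β + γ = α ∧ Multiset.card β = 2 ∧
                  β.prod = χ.valueAtUniformizer v := by
  intro K _ _ hcpt π ℓ _ ι ρ hcomp hrat S hS ψ ρ' hψ hwd hrat'
  -- Step 1: `E`-rationality of `ρ'`
  obtain ⟨E, _, _, e, hρE⟩ := hrat
  have hρ'E : ρ'.IsRationalOver e := hrat' E e hρE
  -- Step 2: Böckle–Hui's Theorem 1.1: `ψ` comes from an algebraic Hecke character `χ₁`
  obtain ⟨χ₁, -, hχ₁⟩ := exists_heckeCharacter_of_weaklyDivides' e hρ'E hwd ι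
  -- Step 3: the twist by `‖·‖³`
  refine ⟨χ₁ * HeckeCharacter.normCharacter K ^ 3, ?_⟩
  filter_upwards [hcomp, hχ₁] with v hv hχv α hα
  obtain ⟨α', hα', -, hP⟩ := hv
  have hαα : α' = α := π.1.hasSatakeParamAt_unique_holds hα' hα
  subst hαα
  obtain ⟨β, hβ, hcard, he⟩ :=
    exists_le_valueAtUniformizer_eq_of_frob ι ρ S hS ψ hψ hP hχv.2.2
  obtain ⟨γ, hγ⟩ := Multiset.le_iff_exists_add.mp hβ
  refine ⟨β, γ, hγ.symm, hcard, ?_⟩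
  have hq0 : (v.residueCard : ℂ) ≠ 0 := by
    exact_mod_cast (lt_trans zero_lt_one v.one_lt_residueCard).ne'
  rw [valueAtUniformizer_mul_eq, valueAtUniformizer_pow_eq,
    HeckeCharacter.valueAtUniformizer_normCharacter, he, show (4 - 1 : ℕ) = 3 from rfl,
    ofReal_sqrt_pow_three_sq, inv_pow, mul_assoc, mul_comm β.prod, ← mul_assoc,
    mul_inv_cancel₀ (pow_ne_zero 3 hq0), one_mul]

end Summit.Langlands.Langlands.Cruxes.ReducibleInducesSquare.Sketch

end
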